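import Summits.NavierStokesRegularity.NavierStokesRegularity.Theses.HodographBetchov

/-!
# Birth skeleton (BC3) for crux `FastClassSqueeze` — route `HodographBetchov`, item stmt-NavierStokesRegularity-15832

The crux, verbatim `Summit.NavierStokesRegularity.NavierStokesRegularity.Theses.HodographBetchov.FastClassSqueeze`:
along every classical solution `(u,p)` of unforced Navier–Stokes on `ℝ³ × [0,T)` that is Leray–Hopf from a
rapidly decaying datum there are a speed level `l > 0`, an exponent `q > 3/2` and a nonnegative majorant
`m(t,x)` of the middle strain eigenvalue on the FAST CLASS `F_l(t) = {x : |u(t,x)| > l}` (min–max form: at every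
fast point some orthonormal 2-frame `v,w` on whose span the quadratic form of `∇u(t,x)` is `≤ m(t,x)`) with the
Miller–Serrin mixed norm `∫₀ᵀ (∫_{F_l(t)} m^q dx)^{2/(2q−3)} dt` finite (`2/p + 3/q = 2`).

## The line: gradient-majorant transfer + energy-starved fast class

Two facts frame the line. (1) KINEMATIC (proved below, `plane_form_le_opNorm`): the operator norm
`‖∇u(t,x)‖` majorises the Rayleigh quotient of `∇u(t,x)` on EVERY 2-plane, so `m := ‖∇u‖` realises the
crux's min–max clause at every point — the crux follows from the FAST-CLASS GRADIENT SERRIN BOUND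
`∫₀ᵀ (∫_{F_l} ‖∇u‖^q)^{2/(2q−3)} < ∞` for some `l, q` (Beirão da Veiga's `∇u ∈ L^p_t L^q_x`, `2/p+3/q = 2`,
demanded only on the fast class). This is a TRANSFER to a strictly stronger but better-instrumented
statement: `|∇u|²` carries the exact energy balance of the moving fast class (card P2:
`d/dt ∫(|u|²−l²)₊/2 = −∮_{|u|=l} p u·n + ν∮_{|u|=l} ∂ₙ|u|²/2 − ν∫_{F_l}|∇u|²`) and the a-priori bound
`ν∫₀ᵀ∫|∇u|² ≤ E₀` (it is `L¹_t` for free; the stub asks for the critical mixed norm on a set of measure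
`≤ 2E₀/l²`), whereas the middle eigenvalue has no evolution law of its own; what is forfeited is Miller's
shape gain, which on Burgers-type fast annuli is a constant (`λ₂ = min(γ,|s|−γ/2) ≍ |∇u|`, card's own
computation), and can be bought back later by replacing `‖∇u‖` with `λ₂⁺` in stub 2 verbatim.
(2) The only a-priori handle on `F_l` is the ENERGY it carries. The line therefore splits the transferred
statement at the one scenario no speed-truncation (De Giorgi / Caffarelli–Vasseur 2010 §3) iteration can
ever absorb — a collapse carrying a fixed quantum of kinetic energy into ever higher speed classes:

* `stub_no_fast_energy_concentration` — **NO ENERGY QUANTUM ESCAPES TO INFINITE SPEED (open,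
  substantive).** For every such solution and every `ε > 0` there is a level `l` with
  `∫_{F_l(t)} |u(t)|² ≤ ε` for ALL `t ∈ [0,T)`: the kinetic energy is uniformly integrable over speed
  classes up to the (possibly singular) time `T`. True slice by slice; the content is uniformity as
  `t ↑ T`. It FOLLOWS from strong `L²`-precompactness of `{u(t)}_{t<T}` (no anomalous dissipation AT the
  first singular instant; Vitali), holds for every self-similar-rate collapse (fast energy `∼ U³a³/l =
  ν³Re³/l → 0`), and fails exactly for strongly Type-II, energy-carrying collapse (core Reynolds number
  `Ua/ν ≳ U^{1/3} → ∞`), which nothing in print excludes. Different OBJECT from the crux (energy, not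
  strain), weaker-looking than regularity, attackable by the fast-class energy balance (P2) and the
  energy-equality literature (Lions `L⁴L⁴`, Cheskidov–Friedlander–Shvydkoy Onsager-critical classes).
* `stub_fast_gradient_serrin_of_no_concentration` — **IN AN ENERGY-STARVED FAST CLASS THE GRADIENT IS
  SERRIN-SQUEEZED (open, the hard core).** For every such solution: if the energy is uniformly integrable
  over speed classes (conclusion of stub 1), then for some level `l > 0` and exponent `q > 3/2`,
  `∫₀ᵀ (∫_{F_l(t)} ‖∇u‖^q dx)^{2/(2q−3)} dt < ∞`. Uniform smallness of the fast excess energy is precisely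
  the initialisation regime of a De Giorgi recurrence over speed levels `l_k ↑ 2l`; closing it at the
  CRITICAL level (the pressure-work flux through the isotachs `{|u| = l_k}` is the known obstruction,
  Caffarelli–Vasseur 2010 §3 / Vasseur 2007) is the open content; it contains the self-similar-rate
  regime, where the target integral is exactly borderline (logarithmic), as a critical bound must be.

Assembly `FastClassSqueeze_of` (kernel-checked; no sorry outside the two stubs): feed stub 1 into stub 2
to get `l, q` and the fast-class gradient Serrin bound; take `m(t,x) := ‖fderiv ℝ (u t) x‖` (nonnegative);
the min–max clause is `plane_form_le_opNorm` (proved here: the first two vectors of the standard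
orthonormal basis, Cauchy–Schwarz, the operator-norm bound and Pythagoras).

Disproof used: none — no `Disproof.lean` / Negative lemma is filed for this crux (crux dir empty at
session start, 2026-08-17); `ledger negatives` for the summit lists nothing on velocity classes.
Sorries: exactly the two `stub_*`. No new definitions; all constants are tree / Mathlib declarations
(`Literature.Analysis.FluidPDE.IsClassicalNSSolutionOn`, `IsLerayHopfOn`, `HasRapidSpatialDecay`,
`fderiv`, `MeasureTheory.lintegral`, `ENNReal.ofReal`, `EuclideanSpace.basisFun`).
-/

namespace Summit.NavierStokesRegularity.NavierStokesRegularity.Cruxes.FastClassSqueeze.Birth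

open MeasureTheory Set

/-- **Kinematic realisation of the min–max clause (proved).** For every continuous linear map `A` of
`ℝ³` there is an orthonormal pair `v, w` (here: the first two standard basis vectors) on whose span the
quadratic form of `A` is bounded by the operator norm: `⟪A ξ, ξ⟫ ≤ ‖A‖ ‖ξ‖² = ‖A‖ (α² + β²)` for
`ξ = α v + β w`. Hence `m := ‖∇u‖` is an admissible majorant in `FastClassSqueeze` at every point. -/
theorem plane_form_le_opNorm (A : EuclideanSpace ℝ (Fin 3) →L[ℝ] EuclideanSpace ℝ (Fin 3)) :
    ∃ v w : EuclideanSpace ℝ (Fin 3), ‖v‖ = 1 ∧ ‖w‖ = 1 ∧ inner ℝ v w = 0 ∧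
      ∀ α β : ℝ, inner ℝ (A (α • v + β • w)) (α • v + β • w) ≤ ‖A‖ * (α ^ 2 + β ^ 2) := by
  classical
  have hv : ‖(EuclideanSpace.basisFun (Fin 3) ℝ) 0‖ = 1 :=
    (EuclideanSpace.basisFun (Fin 3) ℝ).orthonormal.1 0
  have hw : ‖(EuclideanSpace.basisFun (Fin 3) ℝ) 1‖ = 1 :=
    (EuclideanSpace.basisFun (Fin 3) ℝ).orthonormal.1 1
  have hvw : inner ℝ ((EuclideanSpace.basisFun (Fin 3) ℝ) 0) ((EuclideanSpace.basisFun (Fin 3) ℝ) 1) = 0 :=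
    (EuclideanSpace.basisFun (Fin 3) ℝ).orthonormal.2 (by decide)
  refine ⟨(EuclideanSpace.basisFun (Fin 3) ℝ) 0, (EuclideanSpace.basisFun (Fin 3) ℝ) 1, hv, hw, hvw, ?_⟩
  intro α β
  have hnorm : ‖α • (EuclideanSpace.basisFun (Fin 3) ℝ) 0 + β • (EuclideanSpace.basisFun (Fin 3) ℝ) 1‖ ^ 2
      = α ^ 2 + β ^ 2 := by
    rw [norm_add_sq_real, real_inner_smul_left, real_inner_smul_right, hvw, norm_smul, norm_smul, hv, hw]
    simp [sq_abs]
  calc inner ℝ (A (α • (EuclideanSpace.basisFun (Fin 3) ℝ) 0 + β • (EuclideanSpace.basisFun (Fin 3) ℝ) 1))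
          (α • (EuclideanSpace.basisFun (Fin 3) ℝ) 0 + β • (EuclideanSpace.basisFun (Fin 3) ℝ) 1)
        ≤ ‖A (α • (EuclideanSpace.basisFun (Fin 3) ℝ) 0 + β • (EuclideanSpace.basisFun (Fin 3) ℝ) 1)‖ *
            ‖α • (EuclideanSpace.basisFun (Fin 3) ℝ) 0 + β • (EuclideanSpace.basisFun (Fin 3) ℝ) 1‖ :=
          real_inner_le_norm _ _
    _ ≤ (‖A‖ * ‖α • (EuclideanSpace.basisFun (Fin 3) ℝ) 0 + β • (EuclideanSpace.basisFun (Fin 3) ℝ) 1‖) *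
            ‖α • (EuclideanSpace.basisFun (Fin 3) ℝ) 0 + β • (EuclideanSpace.basisFun (Fin 3) ℝ) 1‖ :=
          mul_le_mul_of_nonneg_right (A.le_opNorm _) (norm_nonneg _)
    _ = ‖A‖ * ‖α • (EuclideanSpace.basisFun (Fin 3) ℝ) 0 + β • (EuclideanSpace.basisFun (Fin 3) ℝ) 1‖ ^ 2 := by
          ring
    _ = ‖A‖ * (α ^ 2 + β ^ 2) := by rw [hnorm]

/-- **Stub 1 — no energy quantum escapes to infinite speed (OPEN, substantive).** Along every classical
solution of unforced Navier–Stokes on `ℝ³ × [0,T)` that is Leray–Hopf from a rapidly decaying datum, the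
kinetic energy is uniformly integrable over speed classes up to `T`: for every `ε > 0` there is a speed
level `l > 0` with `∫_{|u(t)| > l} |u(t,x)|² dx ≤ ε` for all `t ∈ [0,T)`. (Slice-wise trivial; the content
is uniformity as `t ↑ T`. Implied by strong `L²`-precompactness of the trajectory up to `T`; violated only
by an energy-carrying strongly Type-II collapse.) -/
theorem stub_no_fast_energy_concentration :
    ∀ (ν T : ℝ), 0 < ν → 0 < T →
      ∀ (u : ℝ → EuclideanSpace ℝ (Fin 3) → EuclideanSpace ℝ (Fin 3)) (p : ℝ → EuclideanSpace ℝ (Fin 3) → ℝ),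
      Literature.Analysis.FluidPDE.IsClassicalNSSolutionOn (Set.Ico 0 T) ν 0 u p →
      Literature.Analysis.FluidPDE.IsLerayHopfOn T ν 0 (u 0) u →
      Literature.Analysis.FluidPDE.HasRapidSpatialDecay (u 0) →
      ∀ ε : ℝ, 0 < ε → ∃ l : ℝ, 0 < l ∧ ∀ t ∈ Set.Ico 0 T,
        ∫⁻ x in {x : EuclideanSpace ℝ (Fin 3) | l < ‖u t x‖}, ‖u t x‖ₑ ^ 2 ≤ ENNReal.ofReal ε := by
  sorry

/-- **Stub 2 — in an energy-starved fast class the gradient is Serrin-squeezed (OPEN, the hard core).**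
Along every classical Leray–Hopf solution from a rapidly decaying datum on `[0,T)`: if the kinetic energy
is uniformly integrable over speed classes up to `T` (conclusion of stub 1), then for some speed level
`l > 0` and some `q > 3/2` the fast-class gradient lies in the Miller–Serrin class,
`∫₀ᵀ (∫_{|u(t)|>l} ‖∇u(t,x)‖^q dx)^{2/(2q−3)} dt < ∞` (`2/p + 3/q = 2` with `p = 2q/(2q−3)`): Beirão da
Veiga's gradient criterion demanded only on the fast class `F_l`, `|F_l(t)| ≤ 2E₀/l²`, in the smallness
regime of the fast excess energy where a De Giorgi recurrence over speed levels is initialised; the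
pressure-work flux through the isotachs is the known obstruction (Caffarelli–Vasseur 2010 §3). -/
theorem stub_fast_gradient_serrin_of_no_concentration :
    ∀ (ν T : ℝ), 0 < ν → 0 < T →
      ∀ (u : ℝ → EuclideanSpace ℝ (Fin 3) → EuclideanSpace ℝ (Fin 3)) (p : ℝ → EuclideanSpace ℝ (Fin 3) → ℝ),
      Literature.Analysis.FluidPDE.IsClassicalNSSolutionOn (Set.Ico 0 T) ν 0 u p →
      Literature.Analysis.FluidPDE.IsLerayHopfOn T ν 0 (u 0) u →
      Literature.Analysis.FluidPDE.HasRapidSpatialDecay (u 0) →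
      (∀ ε : ℝ, 0 < ε → ∃ l : ℝ, 0 < l ∧ ∀ t ∈ Set.Ico 0 T,
        ∫⁻ x in {x : EuclideanSpace ℝ (Fin 3) | l < ‖u t x‖}, ‖u t x‖ₑ ^ 2 ≤ ENNReal.ofReal ε) →
      ∃ l : ℝ, 0 < l ∧ ∃ q : ℝ, 3 / 2 < q ∧
        ∫⁻ t in Set.Ioo 0 T,
          (∫⁻ x in {x : EuclideanSpace ℝ (Fin 3) | l < ‖u t x‖}, ENNReal.ofReal ‖fderiv ℝ (u t) x‖ ^ q)
            ^ (2 / (2 * q - 3)) < ⊤ := by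
  sorry

/-- **Assembly: the crux BY NAME from the two registered stubs BY NAME** (kernel-checked; no direct
`sorry`; read by `#h21_check_skeleton`). Feed stub 1 (no energy concentration in speed) into stub 2
(conditional fast-class gradient Serrin bound) to obtain the level `l`, the exponent `q` and the mixed-norm
bound; take the majorant `m(t,x) := ‖fderiv ℝ (u t) x‖`, which is nonnegative and realises the min–max
clause by `plane_form_le_opNorm`. -/
theorem FastClassSqueeze_of :
    Summit.NavierStokesRegularity.NavierStokesRegularity.Theses.HodographBetchov.FastClassSqueeze := by
  intro ν T hν hT u p hcl hLH hdec
  obtain ⟨l, hl, q, hq, hint⟩ :=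
    stub_fast_gradient_serrin_of_no_concentration ν T hν hT u p hcl hLH hdec
      (stub_no_fast_energy_concentration ν T hν hT u p hcl hLH hdec)
  refine ⟨l, hl, q, hq, fun t x => ‖fderiv ℝ (u t) x‖, fun t x => norm_nonneg _, ?_, ?_⟩
  · intro t _ x _
    exact plane_form_le_opNorm (fderiv ℝ (u t) x)
  · simpa using hint

end Summit.NavierStokesRegularity.NavierStokesRegularity.Cruxes.FastClassSqueeze.Birth
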